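import Literature.NumberTheory.EllipticCurves.MazurTateElementOdd
import Literature.NumberTheory.EllipticCurves.Sprung2017.SharpFlatPAdicLFunctionTwoProofs
import Literature.NumberTheory.EllipticCurves.Sprung2017.SharpFlatPAdicLFunctionUniqueProofs
import Literature.NumberTheory.EllipticCurves.PAdicLFunctionMinusDistributionProofs
import HarnessLib

/-!
# Sprung's ♯/♭ pair EXISTS and is UNIQUE on the ODD branch at `p = 2`
# (`exists_isSprungPairOdd_two`, `IsSprungPairOdd.unique`)

Topic `NumberTheory/EllipticCurves`; `Proofs` companion (theorems only, no definition, no named fact)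
of `Literature.NumberTheory.EllipticCurves.MazurTateElementOdd` (the odd-branch Mazur–Tate element
`mazurTateElementOdd f p n = θ_n(ω^{#Δ/2}, T)` on MINUS modular symbols and the pair predicate
`Sprung2017.IsSprungPairOdd f p a_p L♯ L♭ := ∀ n, θ⁻_n ≡ −(u_n L♯ + v_n L♭) (mod ω_n)`).

Sprung 2017 (Algebra & Number Theory 11, = arXiv:1601.00010), §1.1 and Thm. 1.12, constructs the
vector `(L♯_p(f, ω^i, T), L♭_p(f, ω^i, T))` for EVERY tame character `ω^i` from the Mazur–Tate
elements `θ_n(ω^i, T)` — the construction (§4: queue sequences, Cor. 4.4, "`𝔐 = 0`" for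
supersingular `p`, Cor. 4.10) only uses that the `θ_n(ω^i, T)` form a QUEUE SEQUENCE (Def. 1.7:
the three-term relation `π θ_{n+2} = a_p θ_{n+1} − ν θ_n`) and are `p`-integral. The tree proved the
even branch (`i = 0`: `Sprung2017.exists_isSprungPair_two`, `IsSprungPair.unique`); this file proves
the ODD branch at `p = 2` (`i = 1 = #Δ/2`, `ω = χ₋₄`), which the cell `bsd-f1-sign2` candidate
`BlindOrderOddBranchAtTwo` (Summits-side) quantifies over — asked by the cell's refuter (REF1-AUDIT §11:
"the ∀ over odd pairs is non-vacuous only modulo an `exists_isSprungPairOdd_two` the tree lacks").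

## Route (the printed proof, followed)

1. (§2–§3, `cyclotomicOmega_dvd_threeTermOdd`) the odd elements form a queue sequence:
   `ω_{n+1} ∣ θ⁻_{n+2} − a_p θ⁻_{n+1} + Φ_{p^{n+1}}(1+T) θ⁻_n` in `ℚ[T]` — the MINUS Hecke relation
   `∑_{j<p} [(r+j)/p]⁻ = a_p[r]⁻ − [pr]⁻` (`intCast_mul_ratMinusSymbol`, PROVED in the tree) summed
   along the fibres of `ℤ/p^{n+2+e} → ℤ/p^{n+1+e}`, exactly as in the even case
   (`Sprung2017.cyclotomicOmega_dvd_threeTerm`); the quadratic weight `χ(η)` of the odd branch is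
   constant on each `η`-block. [Sprung 2017, Def. 1.7 / Example 1.8; MTT 1986 §I.10 (10.2)]
2. (§4) at `p = 2`, `4 ∤ N`: `θ⁻_n ∈ ℤ₂[T]` (`exists_map_eq_map_mazurTateElementOdd_two`) from the
   doubling `θ⁻_n = ∑_s 2[γ^s/2^{n+2}]⁻ (1+T)^s` (`mazurTateElementOdd_two_eq`) and
   `‖[a/2^k]⁻‖₂ ≤ 2` (`norm_ratMinusSymbol_two_le_two`). [Sprung 2017, §1.1, Cor. 4.10]
3. (§5–§6) the `p`-UNIFORM construction of `(L♯, L♭)` from integral lifts satisfying the three-term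
   relation — the tree's `Sprung2017.exists_integral_isSprungPair_of_lifts` VERBATIM with the even
   element replaced by an ARBITRARY sequence `θ : ℕ → ℚ[X]` (`exists_integral_pair_of_lifts`:
   approximants, Wronskians `u_{n+1}v_n − v_{n+1}u_n = ω_n/T`, `(p,T)`-adic convergence from
   `u_n, v_n ∈ (p,T)^{⌊n/2⌋}`). [Sprung 2017, Thm. 1.12, Cor. 4.4, "Proposition (yeah)"]
4. (§7) assembly: `exists_isSprungPairOdd_two` for `f` the newform of `E = W`, good reduction at `2`,
   `2 ∣ a₂(E)`.
5. (§8) uniqueness `IsSprungPairOdd.unique` — the tree's `IsSprungPair.unique` argument is about the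
   DIFFERENCE of two pairs and never sees `θ_n`; it is repeated verbatim. [Sprung 2017, Thm. 1.12]

## References
[cite: Sprung2017, §1.1, Def. 1.7, Example 1.8, Thm. 1.12, Cor. 4.4 and Cor. 4.10]
[cite: MazurTateTeitelbaum1986Invent, §I.4 (4.2), §I.8 and §I.10 Prop. (10.2)]
-/

set_option autoImplicit false

noncomputable section

open scoped MatrixGroups ModularForm

open CongruenceSubgroup Polynomial Literature.NumberTheory.EllipticCurves.ModularForms
open Literature.NumberTheory.EllipticCurves

namespace Literature.NumberTheory.EllipticCurves.Sprung2017

/-! ## §1. Reindexing finite sums -/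

section Reindex

variable {M : Type*} [AddCommMonoid M]

/-- Reindexing a sum over `ℤ/m` by the representatives `0 ≤ a.val < m`. [folklore] -/
private theorem sum_univ_zmod_val' (m : ℕ) [NeZero m] (g : ℕ → M) :
    ∑ a : ZMod m, g a.val = ∑ k ∈ Finset.range m, g k := by
  refine Finset.sum_bij (fun a _ ↦ a.val) (fun a _ ↦ Finset.mem_range.mpr (ZMod.val_lt a))
    (fun a _ b _ h ↦ ZMod.val_injective m h) (fun k hk ↦ ?_) (fun _ _ ↦ rfl)
  exact ⟨(k : ZMod m), Finset.mem_univ _, ZMod.val_cast_of_lt (Finset.mem_range.mp hk)⟩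

/-- `∑_{k < a·b} g(k) = ∑_{j < a} ∑_{t < b} g(t + b·j)` (Euclidean division by `b`). [folklore] -/
private theorem sum_range_mul_eq_sum_sum' (a b : ℕ) (g : ℕ → M) :
    ∑ k ∈ Finset.range (a * b), g k =
      ∑ j ∈ Finset.range a, ∑ t ∈ Finset.range b, g (t + b * j) := by
  rw [← Fin.sum_univ_eq_sum_range g (a * b),
    ← finProdFinEquiv.sum_comp (fun x : Fin (a * b) ↦ g x), Fintype.sum_prod_type,
    ← Fin.sum_univ_eq_sum_range (fun j ↦ ∑ t ∈ Finset.range b, g (t + b * j)) a]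
  refine Finset.sum_congr rfl fun j _ ↦ ?_
  rw [← Fin.sum_univ_eq_sum_range (fun t ↦ g (t + b * j)) b]
  refine Finset.sum_congr rfl fun t _ ↦ ?_
  rw [finProdFinEquiv_apply_val]

end Reindex

/-! ## §2. The MINUS Hecke relation at `p` along the fibres of `ℤ/p^{L+1} → ℤ/p^L` -/

section Fiber

variable {N : ℕ} [NeZero N] {f : CuspForm (Gamma0 N) 2} {p : ℕ} [Fact p.Prime]

/-- **The Hecke relation at `p` for MINUS symbols** of the rational newform `f` (`IsNewform0`,
rational coefficients), `p ∤ N`, `a_p(f) = a_p`: `∑_{j<p} [(r + j)/p]⁻_f = a_p [r]⁻_f − [p r]⁻_f`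
(`intCast_mul_ratMinusSymbol`). [cite: MazurTateTeitelbaum1986Invent, §I.4 (4.2)] -/
theorem sum_range_ratMinusSymbol_div_eq_sub (hf0 : IsNewform0 f) (hQ : coeffField f = ⊥)
    (hpN : ¬ p ∣ N) {ap : ℤ} (hap : cuspCoeff f p = ap) (r : ℚ) :
    ∑ j ∈ Finset.range p, ratMinusSymbol f ((r + j) / p) =
      (ap : ℚ) * ratMinusSymbol f r - ratMinusSymbol f (p * r) := by
  have hp : p.Prime := Fact.out
  have h := intCast_mul_ratMinusSymbol (p := p) hf0 hp hpN hap
    (fun r ↦ ratCast_ratMinusSymbol (f := f) (hf := hf0) (hQ := hQ) (r := r)) r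
  rw [Fin.sum_univ_eq_sum_range (fun j ↦ ratMinusSymbol f ((r + j) / p)) p] at h
  linarith

/-- **The fibre sum (minus symbols)**: for `a mod p^L`, summing `[b/p^{L+1}]⁻_f` over the `p`
lifts `b` of `a` to `ℤ/p^{L+1}` gives `a_p [a/p^L]⁻_f − [p · a/p^L]⁻_f`.
[cite: MazurTateTeitelbaum1986Invent, §I.10 Prop. (10.2)] -/
theorem sum_fiber_ratMinusSymbol_eq_sub (hf0 : IsNewform0 f) (hQ : coeffField f = ⊥)
    (hpN : ¬ p ∣ N) {ap : ℤ} (hap : cuspCoeff f p = ap) {L L' : ℕ} (hL : L' = L + 1)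
    (hdvd : p ^ L ∣ p ^ L') (a : ZMod (p ^ L)) :
    ∑ b ∈ Finset.univ.filter (fun b : ZMod (p ^ L') ↦ ZMod.castHom hdvd (ZMod (p ^ L)) b = a),
        ratMinusSymbol f ((b.val : ℚ) / (p : ℚ) ^ L') =
      (ap : ℚ) * ratMinusSymbol f ((a.val : ℚ) / (p : ℚ) ^ L) -
        ratMinusSymbol f (p * ((a.val : ℚ) / (p : ℚ) ^ L)) := by
  classical
  subst hL
  have hp : p.Prime := Fact.out
  haveI : NeZero p := ⟨hp.ne_zero⟩
  have hp0 : (p : ℚ) ≠ 0 := Nat.cast_ne_zero.mpr hp.ne_zero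
  have hinj : Function.Injective
      (fun j : Fin p ↦ ((a.val + p ^ L * (j : ℕ) : ℕ) : ZMod (p ^ (L + 1)))) := by
    intro j j' h
    have hv := congr_arg ZMod.val h
    simp only [val_classLift] at hv
    exact Fin.ext (Nat.eq_of_mul_eq_mul_left (pow_pos hp.pos L) (by omega))
  rw [filter_castHom_eq_image, Finset.sum_image fun j _ j' _ h ↦ hinj h]
  set x : ℚ := (a.val : ℚ) / (p : ℚ) ^ L with hx
  have hA : ∀ j : Fin p,
      ((a.val + p ^ L * (j : ℕ) : ℕ) : ℚ) / (p : ℚ) ^ (L + 1) = (x + j) / p := by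
    intro j
    rw [hx]
    push_cast
    field_simp
    ring
  have hH := sum_range_ratMinusSymbol_div_eq_sub hf0 hQ hpN hap x
  rw [← Fin.sum_univ_eq_sum_range (fun j ↦ ratMinusSymbol f ((x + j) / p)) p] at hH
  rw [← hH]
  refine Finset.sum_congr rfl fun j _ ↦ ?_
  rw [val_classLift, hA]

/-- The fibre of `ℤ/p^{L+1} → ℤ/p^L` over any class has exactly `p` elements. [folklore] -/
private theorem card_filter_castHom_eq' {L L' : ℕ} (hL : L' = L + 1) (hdvd : p ^ L ∣ p ^ L')
    (a : ZMod (p ^ L)) :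
    (Finset.univ.filter (fun b : ZMod (p ^ L') ↦ ZMod.castHom hdvd (ZMod (p ^ L)) b = a)).card
      = p := by
  classical
  subst hL
  have hp : p.Prime := Fact.out
  have hinj : Function.Injective
      (fun j : Fin p ↦ ((a.val + p ^ L * (j : ℕ) : ℕ) : ZMod (p ^ (L + 1)))) := by
    intro j j' h
    have hv := congr_arg ZMod.val h
    simp only [val_classLift] at hv
    exact Fin.ext (Nat.eq_of_mul_eq_mul_left (pow_pos hp.pos L) (by omega))
  rw [filter_castHom_eq_image, Finset.card_image_of_injective _ hinj, Finset.card_univ,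
    Fintype.card_fin]

/-- **An orbit of `δ = γ^{p^{m}}` is a fibre** (as in the even case). [folklore] -/
private theorem image_mul_pow_eq_filter' {L L' : ℕ} (hL : L' = L + 1) (hdvd : p ^ L ∣ p ^ L')
    {b₀ δ : ZMod (p ^ L')} (hb₀ : IsUnit b₀) (hδ : orderOf δ = p)
    (hδ1 : ZMod.castHom hdvd (ZMod (p ^ L)) δ = 1) :
    Finset.univ.image (fun j : Fin p ↦ b₀ * δ ^ (j : ℕ)) =
      Finset.univ.filter (fun b : ZMod (p ^ L') ↦
        ZMod.castHom hdvd (ZMod (p ^ L)) b = ZMod.castHom hdvd (ZMod (p ^ L)) b₀) := by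
  classical
  have hinj : Function.Injective (fun j : Fin p ↦ b₀ * δ ^ (j : ℕ)) := by
    intro j j' h
    have h1 : δ ^ (j : ℕ) = δ ^ (j' : ℕ) := hb₀.mul_right_inj.mp h
    have h2 := pow_injOn_Iio_orderOf (x := δ) (by rw [hδ]; exact j.2) (by rw [hδ]; exact j'.2) h1
    exact Fin.ext h2
  refine Finset.eq_of_subset_of_card_le (fun b hb ↦ ?_) ?_
  · obtain ⟨j, -, rfl⟩ := Finset.mem_image.mp hb
    simp only [Finset.mem_filter, Finset.mem_univ, true_and, map_mul, map_pow, hδ1, one_pow,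
      mul_one]
  · rw [card_filter_castHom_eq' hL hdvd, Finset.card_image_of_injective _ hinj, Finset.card_univ,
      Fintype.card_fin]

/-- **Orbit form of the minus fibre sum**: with `b₀` a unit of `ℤ/p^{L+1}` and `δ` of order `p`
reducing to `1` modulo `p^L`,
`∑_{j<p} [b₀δ^j / p^{L+1}]⁻_f = a_p [(b₀ mod p^L)/p^L]⁻_f − [p · (b₀ mod p^L)/p^L]⁻_f`. [folklore] -/
private theorem sum_range_ratMinusSymbol_orbit_eq_sub (hf0 : IsNewform0 f)
    (hQ : coeffField f = ⊥) (hpN : ¬ p ∣ N) {ap : ℤ} (hap : cuspCoeff f p = ap) {L L' : ℕ}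
    (hL : L' = L + 1) (hdvd : p ^ L ∣ p ^ L') {b₀ δ : ZMod (p ^ L')} (hb₀ : IsUnit b₀)
    (hδ : orderOf δ = p) (hδ1 : ZMod.castHom hdvd (ZMod (p ^ L)) δ = 1) :
    ∑ j ∈ Finset.range p, ratMinusSymbol f (((b₀ * δ ^ j).val : ℚ) / (p : ℚ) ^ L') =
      (ap : ℚ) * ratMinusSymbol f
          (((ZMod.castHom hdvd (ZMod (p ^ L)) b₀).val : ℚ) / (p : ℚ) ^ L) -
        ratMinusSymbol f
          (p * (((ZMod.castHom hdvd (ZMod (p ^ L)) b₀).val : ℚ) / (p : ℚ) ^ L)) := by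
  classical
  have hinj : Function.Injective (fun j : Fin p ↦ b₀ * δ ^ (j : ℕ)) := by
    intro j j' h
    have h1 : δ ^ (j : ℕ) = δ ^ (j' : ℕ) := hb₀.mul_right_inj.mp h
    have h2 := pow_injOn_Iio_orderOf (x := δ) (by rw [hδ]; exact j.2) (by rw [hδ]; exact j'.2) h1
    exact Fin.ext h2
  rw [← sum_fiber_ratMinusSymbol_eq_sub hf0 hQ hpN hap hL hdvd,
    ← image_mul_pow_eq_filter' hL hdvd hb₀ hδ hδ1, Finset.sum_image fun j _ j' _ h ↦ hinj h,
    ← Fin.sum_univ_eq_sum_range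
      (fun j ↦ ratMinusSymbol f (((b₀ * δ ^ j).val : ℚ) / (p : ℚ) ^ L')) p]

/-- `[p · x/p^{S+1}]⁻_f = [(x mod p^S)/p^S]⁻_f` for `x mod p^{S+1}` (periodicity
`ratMinusSymbol_add_intCast`). [folklore] -/
private theorem ratMinusSymbol_mul_div_pow_eq {S I : ℕ} (hI : I = S + 1) (hdvd : p ^ S ∣ p ^ I)
    (x : ZMod (p ^ I)) :
    ratMinusSymbol f (p * ((x.val : ℚ) / (p : ℚ) ^ I)) =
      ratMinusSymbol f (((ZMod.castHom hdvd (ZMod (p ^ S)) x).val : ℚ) / (p : ℚ) ^ S) := by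
  subst hI
  have hp : p.Prime := Fact.out
  haveI : NeZero (p ^ S) := ⟨pow_ne_zero _ hp.ne_zero⟩
  have hp0 : (p : ℚ) ≠ 0 := Nat.cast_ne_zero.mpr hp.ne_zero
  have hval : (ZMod.castHom hdvd (ZMod (p ^ S)) x).val = x.val % p ^ S := by
    rw [ZMod.castHom_apply, ZMod.cast_eq_val, ZMod.val_natCast]
  set q : ℕ := x.val / p ^ S with hq
  set r : ℕ := x.val % p ^ S with hr
  have hx : (x.val : ℚ) = (r : ℚ) + (p : ℚ) ^ S * (q : ℚ) := by
    rw [hr, hq]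
    exact_mod_cast (Nat.mod_add_div x.val (p ^ S)).symm
  have heq : (p : ℚ) * ((x.val : ℚ) / (p : ℚ) ^ (S + 1)) =
      (r : ℚ) / (p : ℚ) ^ S + ((q : ℤ) : ℚ) := by
    rw [hx, Int.cast_natCast, pow_succ]
    field_simp
  rw [heq, ratMinusSymbol_add_intCast, hval]

end Fiber

/-! ## §3. The three-term relation `θ⁻_{n+2} ≡ a_p θ⁻_{n+1} − Φ_{p^{n+1}}(1+T) θ⁻_n (mod ω_{n+1})` -/

section ThreeTerm

variable {N : ℕ} [NeZero N] {f : CuspForm (Gamma0 N) 2} {p : ℕ} [Fact p.Prime]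

omit [NeZero N] in
/-- The image of `θ⁻_m` under a ring homomorphism `φ : ℚ[T] → R`:
`φ(θ⁻_m) = ∑_η φ(χ(η)) ∑_{k < p^m} φ([η γ^k / p^{m+e}]⁻) · φ(1+T)^k`. [folklore] -/
private theorem map_mazurTateElementOdd_eq {R : Type*} [CommRing R] (φ : ℚ[X] →+* R) (m : ℕ)
    [Fintype (rootsOfUnity (torsionOrder p) ℤ_[p])] :
    φ (mazurTateElementOdd f p m) =
      ∑ w : rootsOfUnity (torsionOrder p) ℤ_[p],
        φ (C (torsionQuadChar p ((w : ℤ_[p]ˣ) : ℤ_[p]) : ℚ)) * ∑ k ∈ Finset.range (p ^ m),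
        φ (C (ratMinusSymbol f
          (((PadicInt.toZModPow (m + cyclotomicExponent p) ((w : ℤ_[p]ˣ) : ℤ_[p]) *
              (cyclotomicGenerator p : ZMod (p ^ (m + cyclotomicExponent p))) ^ k).val : ℚ) /
            (p : ℚ) ^ (m + cyclotomicExponent p)))) * φ (X + 1) ^ k := by
  classical
  haveI : NeZero (p ^ m) := ⟨pow_ne_zero _ (Fact.out : p.Prime).ne_zero⟩
  rw [mazurTateElementOdd, finsum_eq_sum_of_fintype, map_sum]
  refine Finset.sum_congr rfl fun w _ ↦ ?_
  rw [map_sum, Finset.mul_sum, ← sum_univ_zmod_val' (p ^ m) (fun k ↦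
      φ (C (torsionQuadChar p ((w : ℤ_[p]ˣ) : ℤ_[p]) : ℚ)) * (φ (C (ratMinusSymbol f
          (((PadicInt.toZModPow (m + cyclotomicExponent p) ((w : ℤ_[p]ˣ) : ℤ_[p]) *
              (cyclotomicGenerator p : ZMod (p ^ (m + cyclotomicExponent p))) ^ k).val : ℚ) /
            (p : ℚ) ^ (m + cyclotomicExponent p)))) * φ (X + 1) ^ k))]
  refine Finset.sum_congr rfl fun s _ ↦ ?_
  rw [map_mul, map_pow, C_mul, map_mul, mul_assoc]

/-- **The three-term relation of the ODD Mazur–Tate elements** (they form a queue sequence in the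
sense of Sprung 2017, Def. 1.7 / Example 1.8; Mazur–Tate–Teitelbaum 1986 §I.10 (10.2)): in `ℚ[T]`,
for `a_p(f) = a_p ∈ ℤ`, `ω_{n+1} ∣ θ⁻_{n+2} − a_p θ⁻_{n+1} + Φ_{p^{n+1}}(1+T) · θ⁻_n`.
Proof: word for word the even case (`cyclotomicOmega_dvd_threeTerm`) with the minus Hecke relation
(`sum_range_ratMinusSymbol_orbit_eq_sub`); the weight `χ(η)` is constant on each `η`-block.
[cite: Sprung2017, Def. 1.7 and Example 1.8; MazurTateTeitelbaum1986Invent, §I.10 Prop. (10.2)] -/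
theorem cyclotomicOmega_dvd_threeTermOdd (hf0 : IsNewform0 f) (hQ : coeffField f = ⊥)
    (hpN : ¬ p ∣ N) {ap : ℤ} (hap : cuspCoeff f p = ap) (n : ℕ) :
    (cyclotomicOmega p (n + 1)).map (Int.castRingHom ℚ) ∣
      mazurTateElementOdd f p (n + 2) - C (ap : ℚ) * mazurTateElementOdd f p (n + 1) +
        ((cyclotomic (p ^ (n + 1)) ℤ).comp (X + 1)).map (Int.castRingHom ℚ) *
          mazurTateElementOdd f p n := by
  classical
  have hp : p.Prime := Fact.out
  haveI := neZero_torsionOrder p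
  haveI := Fintype.ofFinite (rootsOfUnity (torsionOrder p) ℤ_[p])
  have hIS : n + 1 + (cyclotomicExponent p) = (n + (cyclotomicExponent p)) + 1 := by omega
  have hBI : n + 2 + (cyclotomicExponent p) = (n + 1 + (cyclotomicExponent p)) + 1 := by omega
  have hdvdIS : p ^ (n + (cyclotomicExponent p)) ∣ p ^ (n + 1 + (cyclotomicExponent p)) :=
    pow_dvd_pow p (by omega)
  have hdvdBI : p ^ (n + 1 + (cyclotomicExponent p)) ∣ p ^ (n + 2 + (cyclotomicExponent p)) :=
    pow_dvd_pow p (by omega)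
  set ωQ : ℚ[X] := (cyclotomicOmega p (n + 1)).map (Int.castRingHom ℚ) with hωQ
  rw [← AdjoinRoot.mk_eq_zero]
  set π : ℚ[X] →+* AdjoinRoot ωQ := AdjoinRoot.mk ωQ with hπ
  set u : AdjoinRoot ωQ := π (X + 1) with hu
  have hu1 : u ^ p ^ (n + 1) = 1 := by
    have hω : ((X : ℚ[X]) + 1) ^ p ^ (n + 1) - 1 = ωQ := by
      rw [hωQ, cyclotomicOmega, Polynomial.map_sub, Polynomial.map_pow, Polynomial.map_add,
        Polynomial.map_X, Polynomial.map_one]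
    have h0 : π (((X : ℚ[X]) + 1) ^ p ^ (n + 1) - 1) = 0 := by
      rw [hω]
      exact AdjoinRoot.mk_self
    rw [map_sub, map_pow, map_one, sub_eq_zero] at h0
    rw [hu, h0]
  have hupow : ∀ a b : ℕ, u ^ (a + p ^ (n + 1) * b) = u ^ a := fun a b ↦ by
    rw [pow_add, pow_mul, hu1, one_pow, mul_one]
  have hγS : (cyclotomicGenerator p : ZMod (p ^ (n + (cyclotomicExponent p)))) ^ p ^ n = 1 := by
    rw [← orderOf_cyclotomicGenerator p n, pow_orderOf_eq_one]
  have hγI : (cyclotomicGenerator p :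
      ZMod (p ^ (n + 1 + (cyclotomicExponent p)))) ^ p ^ (n + 1) = 1 := by
    rw [← orderOf_cyclotomicGenerator p (n + 1), pow_orderOf_eq_one]
  have hδord : orderOf ((cyclotomicGenerator p :
      ZMod (p ^ (n + 2 + (cyclotomicExponent p)))) ^ p ^ (n + 1)) = p := by
    rw [orderOf_pow' _ (pow_ne_zero _ hp.ne_zero), orderOf_cyclotomicGenerator p (n + 2),
      Nat.gcd_eq_right (pow_dvd_pow p (by omega : n + 1 ≤ n + 2)), Nat.pow_div (by omega) hp.pos,
      show n + 2 - (n + 1) = 1 by omega, pow_one]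
  have hδ1 : ZMod.castHom hdvdBI (ZMod (p ^ (n + 1 + (cyclotomicExponent p))))
      ((cyclotomicGenerator p :
        ZMod (p ^ (n + 2 + (cyclotomicExponent p)))) ^ p ^ (n + 1)) = 1 := by
    rw [map_pow, map_natCast, hγI]
  have hpdiv : ∀ v : ℚ, (p : ℚ) * (v / (p : ℚ) ^ (n + 1 + (cyclotomicExponent p))) =
      v / (p : ℚ) ^ (n + (cyclotomicExponent p)) := by
    intro v
    have hp0 : (p : ℚ) ≠ 0 := Nat.cast_ne_zero.mpr hp.ne_zero
    rw [hIS, pow_succ]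
    field_simp
  -- the weights `χ(η)`
  set χ : rootsOfUnity (torsionOrder p) ℤ_[p] → AdjoinRoot ωQ :=
    fun w ↦ π (C (torsionQuadChar p ((w : ℤ_[p]ˣ) : ℤ_[p]) : ℚ)) with hχ
  set A : rootsOfUnity (torsionOrder p) ℤ_[p] → ℕ → ℚ := fun w k ↦ ratMinusSymbol f
    (((PadicInt.toZModPow (n + (cyclotomicExponent p)) ((w : ℤ_[p]ˣ) : ℤ_[p]) *
        (cyclotomicGenerator p : ZMod (p ^ (n + (cyclotomicExponent p)))) ^ k).val : ℚ) /
          (p : ℚ) ^ (n + (cyclotomicExponent p))) with hA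
  set T : AdjoinRoot ωQ := ∑ w : rootsOfUnity (torsionOrder p) ℤ_[p], χ w *
    ∑ k ∈ Finset.range p, ∑ t ∈ Finset.range (p ^ n), π (C (A w t)) * (u ^ t * (u ^ p ^ n) ^ k)
    with hT
  set A₁ : rootsOfUnity (torsionOrder p) ℤ_[p] → ℕ → ℚ := fun w k ↦ ratMinusSymbol f
    (((PadicInt.toZModPow (n + 1 + (cyclotomicExponent p)) ((w : ℤ_[p]ˣ) : ℤ_[p]) *
        (cyclotomicGenerator p : ZMod (p ^ (n + 1 + (cyclotomicExponent p)))) ^ k).val : ℚ) /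
          (p : ℚ) ^ (n + 1 + (cyclotomicExponent p))) with hA₁
  set Θ₁ : AdjoinRoot ωQ := ∑ w : rootsOfUnity (torsionOrder p) ℤ_[p], χ w *
    ∑ t ∈ Finset.range (p ^ (n + 1)), π (C (A₁ w t)) * u ^ t with hΘ₁
  have hθn : π (mazurTateElementOdd f p n) =
      ∑ w : rootsOfUnity (torsionOrder p) ℤ_[p], χ w * ∑ t ∈ Finset.range (p ^ n),
        π (C (A w t)) * u ^ t := by
    rw [map_mazurTateElementOdd_eq π n]
  have hθn1 : π (mazurTateElementOdd f p (n + 1)) = Θ₁ := by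
    rw [map_mazurTateElementOdd_eq π (n + 1)]
  have hξ : π (((cyclotomic (p ^ (n + 1)) ℤ).comp (X + 1)).map (Int.castRingHom ℚ)) =
      ∑ k ∈ Finset.range p, (u ^ p ^ n) ^ k := by
    rw [cyclotomic_prime_pow_eq_geom_sum hp, Polynomial.sum_comp, Polynomial.map_sum, map_sum]
    refine Finset.sum_congr rfl fun k _ ↦ ?_
    rw [pow_comp, pow_comp, X_comp, Polynomial.map_pow, Polynomial.map_pow, Polynomial.map_add,
      Polynomial.map_X, Polynomial.map_one, map_pow, map_pow]
  have hRHS : π (((cyclotomic (p ^ (n + 1)) ℤ).comp (X + 1)).map (Int.castRingHom ℚ)) *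
      π (mazurTateElementOdd f p n) = T := by
    rw [hξ, hθn, Finset.mul_sum]
    refine Finset.sum_congr rfl fun w _ ↦ ?_
    rw [mul_left_comm, Finset.sum_mul]
    congr 1
    refine Finset.sum_congr rfl fun k _ ↦ ?_
    rw [Finset.mul_sum]
    refine Finset.sum_congr rfl fun t _ ↦ ?_
    ring
  have hLHS : π (mazurTateElementOdd f p (n + 2)) = π (C (ap : ℚ)) * Θ₁ - T := by
    rw [map_mazurTateElementOdd_eq π (n + 2), ← hu]
    have h1 : ∀ w : rootsOfUnity (torsionOrder p) ℤ_[p],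
        ∑ k ∈ Finset.range (p ^ (n + 2)),
          π (C (ratMinusSymbol f
            (((PadicInt.toZModPow (n + 2 + (cyclotomicExponent p)) ((w : ℤ_[p]ˣ) : ℤ_[p]) *
                (cyclotomicGenerator p :
                  ZMod (p ^ (n + 2 + (cyclotomicExponent p)))) ^ k).val : ℚ) /
              (p : ℚ) ^ (n + 2 + (cyclotomicExponent p))))) * u ^ k =
        π (C (ap : ℚ)) * ∑ t ∈ Finset.range (p ^ (n + 1)), π (C (A₁ w t)) * u ^ t -
          ∑ t ∈ Finset.range (p ^ (n + 1)),
            π (C (ratMinusSymbol f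
              (((PadicInt.toZModPow (n + 1 + (cyclotomicExponent p)) ((w : ℤ_[p]ˣ) : ℤ_[p]) *
                  (cyclotomicGenerator p :
                    ZMod (p ^ (n + 1 + (cyclotomicExponent p)))) ^ t).val : ℚ) /
                (p : ℚ) ^ (n + (cyclotomicExponent p))))) * u ^ t := by
      intro w
      rw [show p ^ (n + 2) = p * p ^ (n + 1) by ring, sum_range_mul_eq_sum_sum', Finset.sum_comm,
        Finset.mul_sum, ← Finset.sum_sub_distrib]
      refine Finset.sum_congr rfl fun t _ ↦ ?_
      simp_rw [hupow t]
      rw [← Finset.sum_mul, ← map_sum, ← map_sum, ← mul_assoc, ← map_mul, ← sub_mul, ← map_sub,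
        ← C_mul, ← C_sub]
      congr 3
      set b₀ : ZMod (p ^ (n + 2 + (cyclotomicExponent p))) :=
        PadicInt.toZModPow (n + 2 + (cyclotomicExponent p)) ((w : ℤ_[p]ˣ) : ℤ_[p]) *
          (cyclotomicGenerator p : ZMod (p ^ (n + 2 + (cyclotomicExponent p)))) ^ t with hb₀
      have hb₀u : IsUnit b₀ :=
        ((Units.isUnit _).map _).mul ((isUnit_cyclotomicGenerator_cast p _).pow _)
      have horb := sum_range_ratMinusSymbol_orbit_eq_sub hf0 hQ hpN hap hBI hdvdBI hb₀u hδord hδ1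
      have hcast : ZMod.castHom hdvdBI (ZMod (p ^ (n + 1 + (cyclotomicExponent p)))) b₀ =
          PadicInt.toZModPow (n + 1 + (cyclotomicExponent p)) ((w : ℤ_[p]ˣ) : ℤ_[p]) *
            (cyclotomicGenerator p : ZMod (p ^ (n + 1 + (cyclotomicExponent p)))) ^ t := by
        rw [hb₀, map_mul, map_pow, map_natCast, ZMod.castHom_apply,
          PadicInt.cast_toZModPow _ _ (by omega)]
      rw [hcast, hpdiv] at horb
      rw [hA₁]
      dsimp only
      rw [← horb]
      refine Finset.sum_congr rfl fun j _ ↦ ?_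
      rw [hb₀, pow_add (cyclotomicGenerator p :
          ZMod (p ^ (n + 2 + (cyclotomicExponent p)))) t (p ^ (n + 1) * j),
        pow_mul (cyclotomicGenerator p :
          ZMod (p ^ (n + 2 + (cyclotomicExponent p)))) (p ^ (n + 1)) j, mul_assoc]
    have h2 : ∀ w : rootsOfUnity (torsionOrder p) ℤ_[p],
        ∑ t ∈ Finset.range (p ^ (n + 1)),
          π (C (ratMinusSymbol f
            (((PadicInt.toZModPow (n + 1 + (cyclotomicExponent p)) ((w : ℤ_[p]ˣ) : ℤ_[p]) *
                (cyclotomicGenerator p :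
                  ZMod (p ^ (n + 1 + (cyclotomicExponent p)))) ^ t).val : ℚ) /
              (p : ℚ) ^ (n + (cyclotomicExponent p))))) * u ^ t =
        ∑ k ∈ Finset.range p, ∑ t ∈ Finset.range (p ^ n),
          π (C (A w t)) * (u ^ t * (u ^ p ^ n) ^ k) := by
      intro w
      rw [show p ^ (n + 1) = p * p ^ n by ring, sum_range_mul_eq_sum_sum']
      refine Finset.sum_congr rfl fun k _ ↦ ?_
      refine Finset.sum_congr rfl fun t _ ↦ ?_
      have hx : ∀ x : ZMod (p ^ (n + 1 + (cyclotomicExponent p))),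
          ratMinusSymbol f ((x.val : ℚ) / (p : ℚ) ^ (n + (cyclotomicExponent p))) =
            ratMinusSymbol f (((ZMod.castHom hdvdIS
              (ZMod (p ^ (n + (cyclotomicExponent p)))) x).val : ℚ) /
                (p : ℚ) ^ (n + (cyclotomicExponent p))) := by
        intro x
        rw [← ratMinusSymbol_mul_div_pow_eq (f := f) hIS hdvdIS x, hpdiv]
      rw [hx, map_mul, map_pow, map_natCast, ZMod.castHom_apply,
        PadicInt.cast_toZModPow _ _ (by omega),
        pow_add (cyclotomicGenerator p : ZMod (p ^ (n + (cyclotomicExponent p)))) t (p ^ n * k),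
        pow_mul (cyclotomicGenerator p : ZMod (p ^ (n + (cyclotomicExponent p)))) (p ^ n) k,
        hγS, one_pow, mul_one, pow_add u t (p ^ n * k), pow_mul u (p ^ n) k]
    simp_rw [h1, h2]
    rw [hT, hΘ₁, Finset.mul_sum, ← Finset.sum_sub_distrib]
    refine Finset.sum_congr rfl fun w _ ↦ ?_
    ring
  rw [map_add, map_sub, map_mul, map_mul, hLHS, hRHS, hθn1]
  ring

end ThreeTerm

/-! ## §4. `(p, T)`-adic orders (verbatim from the even file, private there) -/

section Order

variable {p : ℕ} [hp : Fact p.Prime]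

/-- Order `≥ 0` is no condition. [folklore] -/
private theorem pord_zero (P : ℤ_[p][X]) (i : ℕ) : (p : ℤ_[p]) ^ (0 - i) ∣ P.coeff i := by
  rw [Nat.zero_sub, pow_zero]
  exact one_dvd _

/-- Orders add under multiplication (truncated subtraction). [folklore] -/
private theorem pord_mul {K K' : ℕ} {P Q : ℤ_[p][X]} (hP : ∀ i, (p : ℤ_[p]) ^ (K - i) ∣ P.coeff i)
    (hQ : ∀ i, (p : ℤ_[p]) ^ (K' - i) ∣ Q.coeff i) (i : ℕ) :
    (p : ℤ_[p]) ^ (K + K' - i) ∣ (P * Q).coeff i := by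
  rw [coeff_mul]
  refine Finset.dvd_sum fun x hx ↦ ?_
  obtain ⟨a, b⟩ := x
  have hab : a + b = i := Finset.HasAntidiagonal.mem_antidiagonal.mp hx
  calc (p : ℤ_[p]) ^ (K + K' - i) ∣ (p : ℤ_[p]) ^ (K - a) * (p : ℤ_[p]) ^ (K' - b) := by
        rw [← pow_add]
        exact pow_dvd_pow _ (by omega)
    _ ∣ P.coeff a * Q.coeff b := mul_dvd_mul (hP a) (hQ b)

/-- Right multiplication by anything keeps the order. [folklore] -/
private theorem pord_mul_right {K : ℕ} {P : ℤ_[p][X]}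
    (hP : ∀ i, (p : ℤ_[p]) ^ (K - i) ∣ P.coeff i) (Q : ℤ_[p][X]) (i : ℕ) :
    (p : ℤ_[p]) ^ (K - i) ∣ (P * Q).coeff i := by
  have h := pord_mul hP (pord_zero Q) i
  rwa [add_zero] at h

/-- Left multiplication by anything keeps the order. [folklore] -/
private theorem pord_mul_left {K : ℕ} {P : ℤ_[p][X]} (Q : ℤ_[p][X])
    (hP : ∀ i, (p : ℤ_[p]) ^ (K - i) ∣ P.coeff i) (i : ℕ) :
    (p : ℤ_[p]) ^ (K - i) ∣ (Q * P).coeff i := by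
  rw [mul_comm]
  exact pord_mul_right hP Q i

/-- Orders are monotone. [folklore] -/
private theorem pord_mono {K K' : ℕ} (hK : K' ≤ K) {P : ℤ_[p][X]}
    (hP : ∀ i, (p : ℤ_[p]) ^ (K - i) ∣ P.coeff i) (i : ℕ) :
    (p : ℤ_[p]) ^ (K' - i) ∣ P.coeff i :=
  (pow_dvd_pow _ (by omega)).trans (hP i)

end Order

/-! ## §5. Coefficientwise limits in `Λ = ℤ_p⟦T⟧` (verbatim from the even file, private there) -/

section Limits

open Filter _root_.Topology

variable {p : ℕ} [hp : Fact p.Prime]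

/-- **Coefficientwise limits in `ℤ_p⟦T⟧` from `p`-adic divisibility of the steps**: if the
`i`-th coefficient of `P_{M+1} − P_M` is divisible by `p^{⌊M/2⌋ − K₀ − i}` for all `M, i`, then
`P_M` converges coefficientwise to a power series (`ℤ_p` is complete and ultrametric, and the
exponents tend to `∞`) — the mechanism `Λ = lim Λ_n` of Lang, *Cyclotomic Fields I and II*,
Ch. 5 §1 Thm. 1.1, here along half-integral exponents. [cite: Lang1990, Ch. 5 §1 Thm. 1.1] -/
private theorem exists_powerSeries_tendsto_coeff_of_dvd (P : ℕ → ℤ_[p][X]) (K₀ : ℕ)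
    (hP : ∀ M i, (p : ℤ_[p]) ^ (M / 2 - K₀ - i) ∣ (P (M + 1) - P M).coeff i) :
    ∃ L : PowerSeries ℤ_[p], ∀ i,
      Tendsto (fun M ↦ (P M).coeff i) atTop (𝓝 (PowerSeries.coeff i L)) := by
  -- `p^{⌊M/2⌋ - K₀ - i} ∣ (P_{M+k} - P_M)_i`
  have hstep : ∀ M k i, (p : ℤ_[p]) ^ (M / 2 - K₀ - i) ∣ (P (M + k) - P M).coeff i := by
    intro M k i
    induction k with
    | zero =>
      rw [add_zero, sub_self, coeff_zero]
      exact dvd_zero _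
    | succ k ih =>
      have h1 : P (M + (k + 1)) - P M = (P (M + k + 1) - P (M + k)) + (P (M + k) - P M) := by
        rw [← add_assoc]
        ring
      rw [h1, coeff_add]
      exact dvd_add ((pow_dvd_pow _ (by omega)).trans (hP (M + k) i)) ih
  have hnorm : ∀ M k i, ‖(P (M + k)).coeff i - (P M).coeff i‖ ≤
      (p : ℝ) ^ (-((M / 2 - K₀ - i : ℕ) : ℤ)) := by
    intro M k i
    rw [← coeff_sub]
    exact (PadicInt.norm_le_pow_iff_mem_span_pow _ _).mpr
      (Ideal.mem_span_singleton.mpr (hstep M k i))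
  have hcau : ∀ i, CauchySeq (fun M ↦ (P M).coeff i) := fun i ↦ by
    refine Metric.cauchySeq_iff'.mpr fun ε hε ↦ ?_
    obtain ⟨e, he⟩ := PadicInt.exists_pow_neg_lt p hε
    refine ⟨2 * (e + K₀ + i), fun n hn ↦ ?_⟩
    obtain ⟨k, rfl⟩ := Nat.exists_eq_add_of_le hn
    rw [dist_eq_norm]
    refine (hnorm _ k i).trans_lt ?_
    rwa [show 2 * (e + K₀ + i) / 2 - K₀ - i = e by omega]
  choose l hl using fun i ↦ cauchySeq_tendsto_of_complete (hcau i)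
  exact ⟨PowerSeries.mk l, fun i ↦ by rw [PowerSeries.coeff_mk]; exact hl i⟩

/-- Coefficientwise limits commute with multiplication by a fixed polynomial. [folklore] -/
private theorem tendsto_coeff_mul (D : ℤ_[p][X]) {P : ℕ → ℤ_[p][X]} {L : PowerSeries ℤ_[p]}
    (h : ∀ j, Tendsto (fun M ↦ (P M).coeff j) atTop (𝓝 (PowerSeries.coeff j L))) (j : ℕ) :
    Tendsto (fun M ↦ (D * P M).coeff j) atTop
      (𝓝 (PowerSeries.coeff j ((D : PowerSeries ℤ_[p]) * L))) := by
  simp_rw [coeff_mul]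
  rw [PowerSeries.coeff_mul]
  refine tendsto_finsetSum _ fun x _ ↦ ?_
  rw [Polynomial.coeff_coe]
  exact (h x.2).const_mul _

end Limits

/-! ## §6. Construction of `(L♯, L♭)` in `Λ²` for any queue sequence -/

section Construction

open Filter _root_.Topology

variable {p : ℕ} [Fact p.Prime]

/-- **A Sprung pair exists, integrally, for ANY queue sequence — from integral lifts satisfying the
three-term relation** (any prime `p`, `p ∣ a_p`; the tree's `exists_integral_isSprungPair_of_lifts`
VERBATIM with the Mazur–Tate elements replaced by an arbitrary sequence `θ : ℕ → ℚ[T]`, which is all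
its proof uses): given `Θ_n ∈ ℤ_p[T]` lifting the `θ_n` with three-term quotients
`c_n ∈ ℤ_p[T]` (`Θ_{n+2} − a_p Θ_{n+1} + Φ_{p^{n+1}}(1+T) Θ_n = ω_{n+1} c_n`), there are
`L♯, L♭ ∈ Λ = ℤ_p⟦T⟧` with `θ_m + u_m L♯ + v_m L♭ ∈ ω_m Λ` for every `m ≥ 0`. This is the
`p`-UNIFORM part of the construction of `exists_integral_isSprungPair` (approximants `Y_n`,
Wronskians, `(p,T)`-adic convergence — Sprung 2017, Cor. 4.4 / "Proposition (yeah)" `𝔐 = 0` /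
Thm. 1.12), isolated so that the `p = 2` case (Sprung's shift `N = n + 2`, §1.1) only has to supply
the lifts. [cite: Sprung2017, Thm. 1.12, Cor. 4.4 and Cor. 4.10] -/
theorem exists_integral_pair_of_lifts (θ : ℕ → ℚ[X]) {ap : ℤ} (hpa : (p : ℤ) ∣ ap)
    (hΘc : ∃ (Θ c : ℕ → ℤ_[p][X]),
      (∀ n, (Θ n).map (algebraMap ℤ_[p] ℚ_[p]) =
        (θ n).map (algebraMap ℚ ℚ_[p])) ∧
      ∀ n, Θ (n + 2) - C (ap : ℤ_[p]) * Θ (n + 1) +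
          ((cyclotomic (p ^ (n + 1)) ℤ).comp (X + 1)).map (Int.castRingHom ℤ_[p]) * Θ n =
        (cyclotomicOmega p (n + 1)).map (Int.castRingHom ℤ_[p]) * c n) :
    ∃ Ls Lf : IwasawaAlgebra p, ∀ m : ℕ, ∃ Q : IwasawaAlgebra p,
      ((θ m).map (algebraMap ℚ ℚ_[p]) : PowerSeries ℚ_[p]) +
          iwasawaToPowerSeries p
            (toIwasawa p (sharpPoly ap p m) * Ls + toIwasawa p (flatPoly ap p m) * Lf) =
        iwasawaToPowerSeries p
          (((cyclotomicOmega p m).map (Int.castRingHom ℤ_[p]) : PowerSeries ℤ_[p]) * Q) := by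
  classical
  obtain ⟨Θ, c, hΘ, hc⟩ := hΘc
  -- the recursion polynomials and the cyclotomic data over `ℤ_p`
  set U : ℕ → ℤ_[p][X] := fun n ↦ (sharpPoly ap p n).map (Int.castRingHom ℤ_[p]) with hU
  set V : ℕ → ℤ_[p][X] := fun n ↦ (flatPoly ap p n).map (Int.castRingHom ℤ_[p]) with hV
  set Φ : ℕ → ℤ_[p][X] := fun k ↦
    ((cyclotomic (p ^ k) ℤ).comp (X + 1)).map (Int.castRingHom ℤ_[p]) with hΦ
  set Ω : ℕ → ℤ_[p][X] := fun n ↦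
    (∏ i ∈ Finset.range n, (cyclotomic (p ^ (i + 1)) ℤ).comp (X + 1)).map (Int.castRingHom ℤ_[p])
    with hΩ
  set ω : ℕ → ℤ_[p][X] := fun n ↦ (cyclotomicOmega p n).map (Int.castRingHom ℤ_[p]) with hω
  have hU0 : U 0 = 0 := by simp [hU]
  have hU1 : U 1 = 1 := by simp [hU]
  have hV0 : V 0 = 1 := by simp [hV]
  have hV1 : V 1 = 0 := by simp [hV]
  have hU2 : ∀ n, U (n + 2) = C (ap : ℤ_[p]) * U (n + 1) - Φ (n + 1) * U n := fun n ↦ by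
    simp only [hU, hΦ]
    rw [sharpPoly_add_two, Polynomial.map_sub, Polynomial.map_mul, Polynomial.map_mul,
      Polynomial.map_C, eq_intCast]
  have hV2 : ∀ n, V (n + 2) = C (ap : ℤ_[p]) * V (n + 1) - Φ (n + 1) * V n := fun n ↦ by
    simp only [hV, hΦ]
    rw [flatPoly_add_two, Polynomial.map_sub, Polynomial.map_mul, Polynomial.map_mul,
      Polynomial.map_C, eq_intCast]
  have hωΩ : ∀ n, ω n = X * Ω n := fun n ↦ by
    simp only [hω, hΩ]
    rw [← X_mul_prod_cyclotomic_comp_eq_cyclotomicOmega, Polynomial.map_mul, Polynomial.map_X]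
  have hΩs : ∀ n, Ω (n + 1) = Ω n * Φ (n + 1) := fun n ↦ by
    simp only [hΩ, hΦ]
    rw [Finset.prod_range_succ, Polynomial.map_mul]
  have hdet : ∀ n, U (n + 1) * V n - V (n + 1) * U n = Ω n := fun n ↦ by
    simp only [hU, hV, hΩ]
    rw [← Polynomial.map_mul, ← Polynomial.map_mul, ← Polynomial.map_sub,
      sharpPoly_succ_mul_flatPoly_sub]
  have hc' : ∀ n, Θ (n + 2) - C (ap : ℤ_[p]) * Θ (n + 1) + Φ (n + 1) * Θ n =
      X * Ω (n + 1) * c n := fun n ↦ by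
    rw [← hωΩ]
    exact hc n
  -- orders: `u_n, v_n ∈ (p, T)^{⌊n/2⌋}`
  have hUord : ∀ n i, (p : ℤ_[p]) ^ (n / 2 - i) ∣ (U n).coeff i := fun n i ↦
    pow_dvd_coeff_map_sprungSeq hpa 0 1 n i
  have hVord : ∀ n i, (p : ℤ_[p]) ^ (n / 2 - i) ∣ (V n).coeff i := fun n i ↦
    pow_dvd_coeff_map_sprungSeq hpa 1 0 n i
  -- the shifted Wronskians `V m * U (m + j) - U m * V (m + j) = Ω m * W m j`
  choose w hw hwo using fun m j ↦ exists_wronskian_eq_mul (p := p) hpa m j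
  set W : ℕ → ℕ → ℤ_[p][X] := fun m j ↦ (w m j).map (Int.castRingHom ℤ_[p]) with hW
  have hWr : ∀ m j, V m * U (m + j) - U m * V (m + j) = Ω m * W m j := fun m j ↦ by
    simp only [hU, hV, hΩ, hW]
    rw [← Polynomial.map_mul, ← Polynomial.map_mul, ← Polynomial.map_sub, hw,
      Polynomial.map_mul]
  -- the approximants `Y_n = (Θ_1, Θ_0) + T ∑_{k<n} c_k (v_{k+1}, -u_{k+1})`
  set Y₁ : ℕ → ℤ_[p][X] := fun n ↦ Θ 1 + X * ∑ k ∈ Finset.range n, c k * V (k + 1) with hY₁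
  set Y₂ : ℕ → ℤ_[p][X] := fun n ↦ Θ 0 - X * ∑ k ∈ Finset.range n, c k * U (k + 1) with hY₂
  have hY₁s : ∀ n, Y₁ (n + 1) = Y₁ n + X * (c n * V (n + 1)) := fun n ↦ by
    simp only [hY₁, Finset.sum_range_succ]
    ring
  have hY₂s : ∀ n, Y₂ (n + 1) = Y₂ n - X * (c n * U (n + 1)) := fun n ↦ by
    simp only [hY₂, Finset.sum_range_succ]
    ring
  -- Claim A: `Y_n · e_{n+1} = Θ_{n+1}` and `Y_n · e_n = Θ_n`, exactly
  have hA : ∀ n, U (n + 1) * Y₁ n + V (n + 1) * Y₂ n = Θ (n + 1) ∧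
      U n * Y₁ n + V n * Y₂ n = Θ n := by
    intro n
    induction n with
    | zero =>
      simp only [hY₁, hY₂, Finset.sum_range_zero, mul_zero, add_zero, sub_zero, hU0, hU1, hV0,
        hV1]
      constructor <;> ring
    | succ n ih =>
      obtain ⟨ih1, ih2⟩ := ih
      refine ⟨?_, ?_⟩
      · have h3 := hc' n
        rw [hΩs] at h3
        have hd := hdet n
        rw [show n + 1 + 1 = n + 2 by ring, hY₁s, hY₂s, hU2, hV2]
        linear_combination (C (ap : ℤ_[p])) * ih1 - Φ (n + 1) * ih2 +
          X * c n * Φ (n + 1) * hd - h3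
      · rw [hY₁s, hY₂s]
        linear_combination ih1
  -- Claim B: `Y_{m+M} · e_m = Θ_m - ω_m G_m(M)` with `G_m(M) = ∑_{k<M} c_{m+k} W_m(k+1)`
  set G : ℕ → ℕ → ℤ_[p][X] := fun m M ↦ ∑ k ∈ Finset.range M, c (m + k) * W m (k + 1) with hG
  have hGs : ∀ m M, G m (M + 1) = G m M + c (m + M) * W m (M + 1) := fun m M ↦ by
    simp only [hG, Finset.sum_range_succ]
  have hB : ∀ m M, U m * Y₁ (m + M) + V m * Y₂ (m + M) = Θ m - ω m * G m M := by
    intro m M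
    induction M with
    | zero =>
      simp only [hG, Finset.sum_range_zero, mul_zero, sub_zero, add_zero]
      exact (hA m).2
    | succ M ih =>
      have hWm := hWr m (M + 1)
      rw [show m + (M + 1) = m + M + 1 by ring, hY₁s, hY₂s, hGs, hωΩ]
      rw [show m + (M + 1) = m + M + 1 by ring] at hWm
      linear_combination ih - X * c (m + M) * hWm - G m M * hωΩ m
  -- convergence of `Y₁`, `Y₂` and of the `G_m`
  have hY₁c : ∀ M i, (p : ℤ_[p]) ^ (M / 2 - 0 - i) ∣ (Y₁ (M + 1) - Y₁ M).coeff i := by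
    intro M i
    rw [hY₁s, add_sub_cancel_left, Nat.sub_zero]
    exact pord_mono (by omega) (pord_mul_left X (pord_mul_left (c M) (hVord (M + 1)))) i
  have hY₂c : ∀ M i, (p : ℤ_[p]) ^ (M / 2 - 0 - i) ∣ (Y₂ (M + 1) - Y₂ M).coeff i := by
    intro M i
    rw [hY₂s, sub_sub_cancel_left, coeff_neg, dvd_neg, Nat.sub_zero]
    exact pord_mono (by omega) (pord_mul_left X (pord_mul_left (c M) (hUord (M + 1)))) i
  have hGc : ∀ m M i, (p : ℤ_[p]) ^ (M / 2 - 0 - i) ∣ (G m (M + 1) - G m M).coeff i := by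
    intro m M i
    rw [hGs, add_sub_cancel_left, Nat.sub_zero]
    exact pord_mono (by omega) (pord_mul_left (c (m + M)) (hwo m (M + 1))) i
  obtain ⟨y₁, hy₁⟩ := exists_powerSeries_tendsto_coeff_of_dvd Y₁ 0 hY₁c
  obtain ⟨y₂, hy₂⟩ := exists_powerSeries_tendsto_coeff_of_dvd Y₂ 0 hY₂c
  have hq : ∀ m, ∃ Q : PowerSeries ℤ_[p],
      (U m : PowerSeries ℤ_[p]) * y₁ + (V m : PowerSeries ℤ_[p]) * y₂ =
        (Θ m : PowerSeries ℤ_[p]) - (ω m : PowerSeries ℤ_[p]) * Q := by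
    intro m
    obtain ⟨Q, hQ⟩ := exists_powerSeries_tendsto_coeff_of_dvd (G m) 0 (hGc m)
    refine ⟨Q, PowerSeries.ext fun i ↦ ?_⟩
    -- both sides are limits of the `i`-th coefficient of Claim B along `M ↦ m + M`
    have hshift : ∀ (Y : ℕ → ℤ_[p][X]) (y : PowerSeries ℤ_[p]),
        (∀ j, Tendsto (fun M ↦ (Y M).coeff j) atTop (𝓝 (PowerSeries.coeff j y))) →
        ∀ j, Tendsto (fun M ↦ (Y (m + M)).coeff j) atTop (𝓝 (PowerSeries.coeff j y)) := by
      intro Y y hY j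
      have h3 : (fun M ↦ (Y (m + M)).coeff j) = fun M ↦ (fun n ↦ (Y n).coeff j) (M + m) := by
        ext M
        rw [add_comm]
      rw [h3]
      exact (tendsto_add_atTop_iff_nat m).mpr (hY j)
    have h1 : Tendsto (fun M ↦ (U m * Y₁ (m + M) + V m * Y₂ (m + M)).coeff i) atTop
        (𝓝 (PowerSeries.coeff i ((U m : PowerSeries ℤ_[p]) * y₁ + (V m : PowerSeries ℤ_[p]) * y₂))) := by
      simp_rw [coeff_add]
      rw [map_add]
      exact (tendsto_coeff_mul (U m) (hshift Y₁ y₁ hy₁) i).add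
        (tendsto_coeff_mul (V m) (hshift Y₂ y₂ hy₂) i)
    have h2 : Tendsto (fun M ↦ (U m * Y₁ (m + M) + V m * Y₂ (m + M)).coeff i) atTop
        (𝓝 (PowerSeries.coeff i ((Θ m : PowerSeries ℤ_[p]) - (ω m : PowerSeries ℤ_[p]) * Q))) := by
      simp_rw [hB, coeff_sub]
      rw [map_sub, Polynomial.coeff_coe]
      exact tendsto_const_nhds.sub (tendsto_coeff_mul (ω m) hQ i)
    exact tendsto_nhds_unique h1 h2
  -- `(L♯, L♭) = -lim Y`
  refine ⟨-y₁, -y₂, fun m ↦ ?_⟩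
  obtain ⟨Q, hQm⟩ := hq m
  refine ⟨Q, ?_⟩
  have hθ : (((θ m).map (algebraMap ℚ ℚ_[p]) : ℚ_[p][X]) :
      PowerSeries ℚ_[p]) = iwasawaToPowerSeries p (Θ m : PowerSeries ℤ_[p]) := by
    rw [← hΘ, Polynomial.polynomial_map_coe]
  have htoI : ∀ q : ℤ[X], toIwasawa p q =
      ((q.map (Int.castRingHom ℤ_[p]) : ℤ_[p][X]) : PowerSeries ℤ_[p]) := fun q ↦ rfl
  have key : (Θ m : PowerSeries ℤ_[p]) +
      (toIwasawa p (sharpPoly ap p m) * -y₁ + toIwasawa p (flatPoly ap p m) * -y₂) =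
        ((cyclotomicOmega p m).map (Int.castRingHom ℤ_[p]) : PowerSeries ℤ_[p]) * Q := by
    rw [htoI, htoI]
    change (Θ m : PowerSeries ℤ_[p]) + ((U m : PowerSeries ℤ_[p]) * -y₁ +
      (V m : PowerSeries ℤ_[p]) * -y₂) = (ω m : PowerSeries ℤ_[p]) * Q
    linear_combination (-1 : PowerSeries ℤ_[p]) * hQm
  rw [hθ, ← map_add, key]

end Construction

/-! ## §7. The odd branch at `p = 2`: integral lifts, the three-term relation in `ℤ₂[T]`, and
Sprung's pair -/

section Two

variable {N : ℕ} [NeZero N] {f : CuspForm (Gamma0 N) 2}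

omit [NeZero N] in
/-- **Monic descent**: for `D, P ∈ ℤ_p[T]` with `D` monic, `D ∣ P` in `ℚ_p[T]` implies `D ∣ P` in
`ℤ_p[T]`. [folklore] -/
private theorem dvd_of_map_dvd_map' {p : ℕ} [Fact p.Prime] {D P : ℤ_[p][X]} (hD : D.Monic)
    (h : D.map (algebraMap ℤ_[p] ℚ_[p]) ∣ P.map (algebraMap ℤ_[p] ℚ_[p])) : D ∣ P := by
  rw [← modByMonic_eq_zero_iff_dvd hD]
  apply Polynomial.map_injective (algebraMap ℤ_[p] ℚ_[p]) (IsFractionRing.injective ℤ_[p] ℚ_[p])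
  rw [Polynomial.map_modByMonic _ hD, Polynomial.map_zero]
  exact (modByMonic_eq_zero_iff_dvd (hD.map _)).mpr h

omit [NeZero N] in
/-- The two routes `ℤ[T] → ℚ[T] → ℚ_p[T]` and `ℤ[T] → ℤ_p[T] → ℚ_p[T]` agree. [folklore] -/
private theorem map_map_int_eq' {p : ℕ} [Fact p.Prime] (q : ℤ[X]) :
    (q.map (Int.castRingHom ℚ)).map (algebraMap ℚ ℚ_[p]) =
      (q.map (Int.castRingHom ℤ_[p])).map (algebraMap ℤ_[p] ℚ_[p]) := by
  rw [Polynomial.map_map, Polynomial.map_map,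
    RingHom.ext_int ((algebraMap ℚ ℚ_[p]).comp (Int.castRingHom ℚ))
      ((algebraMap ℤ_[p] ℚ_[p]).comp (Int.castRingHom ℤ_[p]))]

/-- **The odd three-term relation in `ℤ_p[T]`, from integral lifts** (any prime `p`, `p ∤ N`):
if every `θ⁻_n` lifts to `ℤ_p[T]`, there are lifts `Θ_n` and `c_n ∈ ℤ_p[T]` with
`Θ_{n+2} − a_p Θ_{n+1} + Φ_{p^{n+1}}(1+T) Θ_n = ω_{n+1} · c_n` (monic descent of
`cyclotomicOmega_dvd_threeTermOdd`; the even twin is `exists_lifts_threeTerm_of_lifts`).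
[cite: Sprung2017, Def. 1.7, Example 1.8 and Cor. 4.10] -/
theorem exists_lifts_threeTermOdd_of_lifts {p : ℕ} [Fact p.Prime] (hf0 : IsNewform0 f)
    (hQ : coeffField f = ⊥) (hpN : ¬ p ∣ N) {ap : ℤ} (hap : cuspCoeff f p = ap)
    (hlift : ∀ n, ∃ Θ : ℤ_[p][X], Θ.map (algebraMap ℤ_[p] ℚ_[p]) =
      (mazurTateElementOdd f p n).map (algebraMap ℚ ℚ_[p])) :
    ∃ (Θ c : ℕ → ℤ_[p][X]),
      (∀ n, (Θ n).map (algebraMap ℤ_[p] ℚ_[p]) =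
        (mazurTateElementOdd f p n).map (algebraMap ℚ ℚ_[p])) ∧
      ∀ n, Θ (n + 2) - C (ap : ℤ_[p]) * Θ (n + 1) +
          ((cyclotomic (p ^ (n + 1)) ℤ).comp (X + 1)).map (Int.castRingHom ℤ_[p]) * Θ n =
        (cyclotomicOmega p (n + 1)).map (Int.castRingHom ℤ_[p]) * c n := by
  classical
  choose Θ hΘ using hlift
  have hdvd : ∀ n, (cyclotomicOmega p (n + 1)).map (Int.castRingHom ℤ_[p]) ∣
      Θ (n + 2) - C (ap : ℤ_[p]) * Θ (n + 1) +
        ((cyclotomic (p ^ (n + 1)) ℤ).comp (X + 1)).map (Int.castRingHom ℤ_[p]) * Θ n := by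
    intro n
    refine dvd_of_map_dvd_map' ((monic_cyclotomicOmega p (n + 1)).map _) ?_
    have hmap : (Θ (n + 2) - C (ap : ℤ_[p]) * Θ (n + 1) +
        ((cyclotomic (p ^ (n + 1)) ℤ).comp (X + 1)).map (Int.castRingHom ℤ_[p]) * Θ n).map
          (algebraMap ℤ_[p] ℚ_[p]) =
        (mazurTateElementOdd f p (n + 2) - C (ap : ℚ) * mazurTateElementOdd f p (n + 1) +
          ((cyclotomic (p ^ (n + 1)) ℤ).comp (X + 1)).map (Int.castRingHom ℚ) *
            mazurTateElementOdd f p n).map (algebraMap ℚ ℚ_[p]) := by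
      rw [Polynomial.map_add, Polynomial.map_sub, Polynomial.map_mul, Polynomial.map_mul,
        Polynomial.map_C, hΘ, hΘ, hΘ, ← map_map_int_eq', Polynomial.map_add, Polynomial.map_sub,
        Polynomial.map_mul, Polynomial.map_mul, Polynomial.map_C]
      simp only [map_intCast]
    rw [← map_map_int_eq', hmap]
    exact Polynomial.map_dvd _ (cyclotomicOmega_dvd_threeTermOdd hf0 hQ hpN hap n)
  choose c hc using hdvd
  exact ⟨Θ, c, hΘ, hc⟩

/-- **`θ⁻_n ∈ ℤ₂[T]` for `4 ∤ N`** (real coefficients): by the doubling at `p = 2`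
(`mazurTateElementOdd_two_eq`: every coefficient of `θ⁻_n` is `2·[5^s/2^{n+2}]⁻_f`) and
`‖[a/2^k]⁻_f‖₂ ≤ 2` (`norm_ratMinusSymbol_two_le_two`, Mazur–Tate–Teitelbaum §I.8), each coefficient
has `2`-adic norm `≤ 1`, so the image of `θ⁻_n` in `ℚ₂[T]` lifts to `ℤ₂[T]` (the odd-branch case of
Sprung 2017, Cor. 4.10 at `p = 2`, shift `N = n + 2` of §1.1). [cite: Sprung2017, §1.1 and Cor. 4.10] -/
theorem exists_map_eq_map_mazurTateElementOdd_two (hreal : ∀ n, (cuspCoeff f n).im = 0)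
    (h4 : ¬ 4 ∣ N) (n : ℕ) :
    ∃ Θ : ℤ_[2][X], Θ.map (algebraMap ℤ_[2] ℚ_[2]) =
      (mazurTateElementOdd f 2 n).map (algebraMap ℚ ℚ_[2]) := by
  classical
  rw [← Polynomial.mem_lifts, mazurTateElementOdd_two_eq, Polynomial.map_sum]
  refine Subsemiring.sum_mem _ fun s _ ↦ ?_
  rw [Polynomial.map_mul, Polynomial.map_pow, Polynomial.map_add, Polynomial.map_X,
    Polynomial.map_one, Polynomial.map_C]
  refine Subsemiring.mul_mem _ ?_ (Subsemiring.pow_mem _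
    (Subsemiring.add_mem _ (X_mem_lifts _) (Subsemiring.one_mem _)) _)
  set q : ℚ := ratMinusSymbol f
    ((((cyclotomicGenerator 2 : ZMod (2 ^ (n + 2))) ^ s.val).val : ℚ) / (2 : ℚ) ^ (n + 2)) with hq
  have hden : ((((cyclotomicGenerator 2 : ZMod (2 ^ (n + 2))) ^ s.val).val : ℚ) /
      (2 : ℚ) ^ (n + 2)).den ∣ 2 ^ (n + 2) := by
    have h := Rat.den_dvd (((cyclotomicGenerator 2 : ZMod (2 ^ (n + 2))) ^ s.val).val : ℤ)
      ((2 : ℤ) ^ (n + 2))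
    rw [Rat.divInt_eq_div] at h
    push_cast at h
    exact_mod_cast h
  have hqn : ‖(q : ℚ_[2])‖ ≤ 2 := norm_ratMinusSymbol_two_le_two f hreal h4 hden
  have h2 : ‖(2 : ℚ_[2])‖ = (2 : ℝ)⁻¹ := by
    have h := Padic.norm_p (p := 2)
    simpa using h
  have hnorm : ‖((2 * q : ℚ) : ℚ_[2])‖ ≤ 1 := by
    push_cast
    rw [norm_mul, h2]
    calc (2 : ℝ)⁻¹ * ‖(q : ℚ_[2])‖ ≤ (2 : ℝ)⁻¹ * 2 := by gcongr
      _ = 1 := by norm_num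
  have heq : algebraMap ℚ ℚ_[2] (2 * q) = algebraMap ℤ_[2] ℚ_[2] ⟨((2 * q : ℚ) : ℚ_[2]), hnorm⟩ := by
    rw [eq_ratCast]
    rfl
  rw [heq]
  exact C_mem_lifts _ _

/-- **Sprung's ODD-branch pair exists at `2`, integrally**: for `f` rational of level `N` with
`2 ∤ N` and `a₂(f) = a₂` EVEN, there are `L♯, L♭ ∈ Λ = ℤ₂⟦T⟧` with
`θ⁻_m + u_m L♯ + v_m L♭ ∈ ω_m Λ` for every `m ≥ 0`. [cite: Sprung2017, §1.1, Thm. 1.12, Cor. 4.4 and Cor. 4.10] -/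
theorem exists_integral_isSprungPairOdd_two (hf0 : IsNewform0 f) (hQ : coeffField f = ⊥)
    (hN : ¬ 2 ∣ N) {ap : ℤ} (hap : cuspCoeff f 2 = ap) (hpa : (2 : ℤ) ∣ ap) :
    ∃ Ls Lf : IwasawaAlgebra 2, ∀ m : ℕ, ∃ Q : IwasawaAlgebra 2,
      ((mazurTateElementOdd f 2 m).map (algebraMap ℚ ℚ_[2]) : PowerSeries ℚ_[2]) +
          iwasawaToPowerSeries 2
            (toIwasawa 2 (sharpPoly ap 2 m) * Ls + toIwasawa 2 (flatPoly ap 2 m) * Lf) =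
        iwasawaToPowerSeries 2
          (((cyclotomicOmega 2 m).map (Int.castRingHom ℤ_[2]) : PowerSeries ℤ_[2]) * Q) := by
  have hreal : ∀ n, (cuspCoeff f n).im = 0 := cuspCoeff_im_eq_zero_of_coeffField_eq_bot hQ
  have h4 : ¬ 4 ∣ N := fun h ↦ hN (dvd_trans (by norm_num) h)
  exact exists_integral_pair_of_lifts (mazurTateElementOdd f 2) (by exact_mod_cast hpa)
    (exists_lifts_threeTermOdd_of_lifts hf0 hQ hN hap
      fun n ↦ exists_map_eq_map_mazurTateElementOdd_two hreal h4 n)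

variable {W : WeierstrassCurve ℚ} [W.IsElliptic] [W.IsGloballyMinimal]

/-- **Sprung's ♯/♭ pair EXISTS on the ODD branch at `p = 2`**: for `f` the newform of `E = W`
(`IsNewformOf W f`), `E` with good reduction at `2` and `2 ∣ a₂(E)` (good SUPERSINGULAR reduction
at `2`), there are `L♯₋, L♭₋ ∈ Λ = ℤ₂⟦T⟧` with `θ⁻_n ≡ −(u_n L♯₋ + v_n L♭₋) (mod ω_n)` for all `n`
(`IsSprungPairOdd f 2 (a₂(E)) L♯₋ L♭₋`, in fact integrally: exponent `0` in `IsCongrModOmega`) —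
the `ω = χ₋₄` column of Sprung 2017, Thm. 1.12 at `p = 2` (shift `N = n + 2`, §1.1). Assembly as
in the even twin `exists_isSprungPair_two`. [cite: Sprung2017, §1.1, Thm. 1.12, Cor. 4.4 and Cor. 4.10] -/
theorem exists_isSprungPairOdd_two (hf : IsNewformOf W f) (hgood : W.HasGoodReductionAtPrime 2)
    (hap : (2 : ℤ) ∣ W.frobeniusTrace 2) :
    ∃ Lsharp Lflat : IwasawaAlgebra 2,
      IsSprungPairOdd f 2 (W.frobeniusTrace 2) Lsharp Lflat := by
  have hf0 : IsNewform0 f := hf.1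
  have hQ : coeffField f = ⊥ := hf.coeffField_eq_bot
  have hpN : ¬ 2 ∣ N := not_dvd_level_of_isNewformOf hf hgood
  have hap' : cuspCoeff f 2 = ((W.frobeniusTrace 2 : ℤ) : ℂ) :=
    cuspCoeff_eq_frobeniusTrace_of_isNewformOf_holds hf hgood
  obtain ⟨Ls, Lf, h⟩ := exists_integral_isSprungPairOdd_two hf0 hQ hpN hap' hap
  refine ⟨Ls, Lf, fun m ↦ ?_⟩
  obtain ⟨Q, hQm⟩ := h m
  refine ⟨0, Q, ?_⟩
  rw [pow_zero, map_one, one_mul, Polynomial.map_neg, Polynomial.map_one, Polynomial.coe_neg,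
    Polynomial.coe_one, neg_one_mul, map_neg, sub_neg_eq_add, hQm]

end Two

/-! ## §8. Uniqueness on the odd branch -/

section Unique

variable {p : ℕ} [hp : Fact p.Prime] {N : ℕ} {f : CuspForm (Gamma0 N) 2}

/-- `toIwasawa` is "map the coefficients to `ℤ_p` and view the polynomial as a power series".
[folklore] -/
private theorem toIwasawa_apply' (q : ℤ[X]) :
    toIwasawa p q = ((q.map (Int.castRingHom ℤ_[p]) : ℤ_[p][X]) : PowerSeries ℤ_[p]) := rfl

/-- `toIwasawa T = T`. [folklore] -/
private theorem toIwasawa_X' : toIwasawa p (X : ℤ[X]) = PowerSeries.X := by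
  rw [toIwasawa_apply', Polynomial.map_X, Polynomial.coe_X]

/-- The image of `Π_n = ∏_{i<n} Φ_{p^{i+1}}(1+T)` (a monic polynomial) in `Λ` is non-zero.
[folklore] -/
private theorem toIwasawa_prod_cyclotomic_ne_zero' (n : ℕ) :
    toIwasawa p (∏ i ∈ Finset.range n, (cyclotomic (p ^ (i + 1)) ℤ).comp (X + 1)) ≠ 0 := by
  have hmonic : (∏ i ∈ Finset.range n, (cyclotomic (p ^ (i + 1)) ℤ).comp (X + 1)).Monic := by
    refine monic_prod_of_monic _ _ fun i _ ↦ (cyclotomic.monic _ ℤ).comp (monic_X_add_C 1) ?_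
    rw [← C_1, natDegree_X_add_C]
    exact one_ne_zero
  rw [toIwasawa_apply', Ne, Polynomial.coe_eq_zero_iff]
  exact (hmonic.map (Int.castRingHom ℤ_[p])).ne_zero

/-- An element of `ℤ_p` divisible by every power of `p` is `0`. [folklore] -/
private theorem padicInt_eq_zero_of_forall_pow_dvd' (x : ℤ_[p]) (h : ∀ k : ℕ, (p : ℤ_[p]) ^ k ∣ x) :
    x = 0 := by
  by_contra hx
  have hpos : 0 < ‖x‖ := norm_pos_iff.mpr hx
  have hp1 : ((p : ℝ)⁻¹) < 1 := inv_lt_one_of_one_lt₀ (by exact_mod_cast hp.out.one_lt)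
  have hp0 : 0 ≤ ((p : ℝ)⁻¹) := inv_nonneg.mpr (by exact_mod_cast (Nat.zero_le p))
  obtain ⟨k, hk⟩ := exists_pow_lt_of_lt_one hpos hp1
  have hle : ‖x‖ ≤ (p : ℝ) ^ (-(k : ℤ)) :=
    (PadicInt.norm_le_pow_iff_mem_span_pow x k).mpr (Ideal.mem_span_singleton.mpr (h k))
  rw [zpow_neg, zpow_natCast, ← inv_pow] at hle
  exact absurd (hle.trans_lt hk) (lt_irrefl _)

/-- **Uniqueness of Sprung's pair on the ODD branch (Sprung 2017, Thm. 1.12: "there is a unique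
vector of two Iwasawa functions", for every tame character).** The even twin `IsSprungPair.unique`
VERBATIM — the argument is about the difference of two pairs and never sees `θ_n`. For `p ∣ a_p` (good SUPERSINGULAR reduction), two pairs `(L♯, L♭)`,
`(L♯', L♭')` in `Λ²` satisfying the Mazur–Tate congruences `θ_n ≡ −(u_n L♯ + v_n L♭) (mod ω_n)` for
all `n` (`IsSprungPair f p a_p`) are EQUAL. Proof in `Λ` (no `α, β`, no `𝓛og`): the differences
`a, b` satisfy `u_n a + v_n b ∈ ω_n Λ` integrally (`IsCongrModOmega.exists_mul_sub_eq`); the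
Wronskian `u_{n+1} v_n − v_{n+1} u_n = ω_n/T` (Sprung's `det 𝒞_1⋯𝒞_n = ∏Φ_{p^i}(1+T)`) solves for
`a ∈ T·(v_n, v_{n+1})Λ`, `b ∈ T·(u_n, u_{n+1})Λ` for every `n`, and `u_n, v_n ∈ (p,T)^{⌊n/2⌋}`
(Sprung's "`𝔐 = 0`" for supersingular `p`) forces every coefficient of `a`, `b` to be divisible by
all powers of `p`. [cite: Sprung2017, Thm. 1.12 (uniqueness), Remark 3.1 and §4 Cor. 4.4] -/
theorem IsSprungPairOdd.unique {ap : ℤ} (hap : (p : ℤ) ∣ ap) {A B A' B' : IwasawaAlgebra p}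
    (h : IsSprungPairOdd f p ap A B) (h' : IsSprungPairOdd f p ap A' B') :
    A = A' ∧ B = B' := by
  -- notation: `τ = toIwasawa`, `u n`, `v n`, `Φ n`, `Pr n`, `Ω n`
  set a : IwasawaAlgebra p := A - A' with ha_def
  set b : IwasawaAlgebra p := B - B' with hb_def
  set u : ℕ → IwasawaAlgebra p := fun n ↦ toIwasawa p (sharpPoly ap p n) with hu_def
  set v : ℕ → IwasawaAlgebra p := fun n ↦ toIwasawa p (flatPoly ap p n) with hv_def
  set Φ : ℕ → IwasawaAlgebra p := fun n ↦ toIwasawa p ((cyclotomic (p ^ n) ℤ).comp (X + 1))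
    with hΦ_def
  set Pr : ℕ → IwasawaAlgebra p :=
    fun n ↦ toIwasawa p (∏ i ∈ Finset.range n, (cyclotomic (p ^ (i + 1)) ℤ).comp (X + 1)) with hPr_def
  set Ω : ℕ → IwasawaAlgebra p :=
    fun n ↦ ((cyclotomicOmega p n).map (Int.castRingHom ℤ_[p]) : PowerSeries ℤ_[p]) with hΩ_def
  -- Step 1: integral congruences `u_n a + v_n b = Ω_n r_n`
  have E : ∀ n, ∃ r : IwasawaAlgebra p, u n * a + v n * b = Ω n * r := by
    intro n
    obtain ⟨r, hr⟩ := (h n).exists_mul_sub_eq (h' n)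
    have hneg : (((-1 : ℤ[X]).map (Int.castRingHom ℤ_[p]) : ℤ_[p][X]) : PowerSeries ℤ_[p]) = -1 := by
      rw [Polynomial.map_neg, Polynomial.map_one, Polynomial.coe_neg, Polynomial.coe_one]
    rw [hneg] at hr
    refine ⟨-r, ?_⟩
    simp only [hu_def, hv_def, ha_def, hb_def, hΩ_def]
    linear_combination -hr
  choose r hr using E
  -- the Wronskian, `Ω_n = T·Π_n`, `Ω_{n+1} = Ω_n Φ_{n+1}`
  have W : ∀ n, u (n + 1) * v n - v (n + 1) * u n = Pr n := by
    intro n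
    simp only [hu_def, hv_def, hPr_def, ← map_mul, ← map_sub]
    rw [sharpPoly_succ_mul_flatPoly_sub]
  have hΩ : ∀ n, Ω n = toIwasawa p X * Pr n := by
    intro n
    simp only [hΩ_def, hPr_def, ← map_mul]
    rw [X_mul_prod_cyclotomic_comp_eq_cyclotomicOmega, toIwasawa_apply']
  have hΩsucc : ∀ n, Ω (n + 1) = Ω n * Φ (n + 1) := by
    intro n
    simp only [hΩ_def, hΦ_def]
    rw [cyclotomicOmega_succ, toIwasawa_apply', Polynomial.map_mul, Polynomial.coe_mul]
  have hPr : ∀ n, Pr n ≠ 0 := fun n ↦ toIwasawa_prod_cyclotomic_ne_zero' n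
  -- Step 2: elimination
  have hA : ∀ n, a = toIwasawa p X * (Φ (n + 1) * r (n + 1) * v n - r n * v (n + 1)) := by
    intro n
    apply mul_left_cancel₀ (hPr n)
    have e1 := hr n
    have e2 := hr (n + 1)
    rw [hΩsucc, hΩ] at e2
    rw [hΩ] at e1
    linear_combination (v n) * e2 - (v (n + 1)) * e1 - a * W n
  have hB : ∀ n, b = toIwasawa p X * (r n * u (n + 1) - Φ (n + 1) * r (n + 1) * u n) := by
    intro n
    apply mul_left_cancel₀ (hPr n)
    have e1 := hr n
    have e2 := hr (n + 1)
    rw [hΩsucc, hΩ] at e2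
    rw [hΩ] at e1
    linear_combination (u (n + 1)) * e1 - (u n) * e2 - b * W n
  -- Step 3: `(p,T)`-adic bounds on `u_n`, `v_n`
  have hu : ∀ n j, (p : ℤ_[p]) ^ (n / 2 - j) ∣ PowerSeries.coeff j (u n) := by
    intro n j
    simp only [hu_def, toIwasawa_apply', Polynomial.coeff_coe]
    exact pow_dvd_coeff_map_sprungSeq hap 0 1 n j
  have hv : ∀ n j, (p : ℤ_[p]) ^ (n / 2 - j) ∣ PowerSeries.coeff j (v n) := by
    intro n j
    simp only [hv_def, toIwasawa_apply', Polynomial.coeff_coe]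
    exact pow_dvd_coeff_map_sprungSeq hap 1 0 n j
  have hu' : ∀ n j, (p : ℤ_[p]) ^ (n / 2 - j) ∣ PowerSeries.coeff j (u (n + 1)) := fun n j ↦
    (pow_dvd_pow _ (by omega)).trans (hu (n + 1) j)
  have hv' : ∀ n j, (p : ℤ_[p]) ^ (n / 2 - j) ∣ PowerSeries.coeff j (v (n + 1)) := fun n j ↦
    (pow_dvd_pow _ (by omega)).trans (hv (n + 1) j)
  -- coefficients of `a` and `b` are divisible by every power of `p`
  have hcoeffA : ∀ n j, (p : ℤ_[p]) ^ (n / 2 - j) ∣ PowerSeries.coeff (j + 1) a := by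
    intro n j
    rw [hA n, toIwasawa_X', PowerSeries.coeff_succ_X_mul, map_sub]
    exact dvd_sub (MAdic.dvd_coeff_mul_of_dvd_coeff p (hv n) _ j)
      (MAdic.dvd_coeff_mul_of_dvd_coeff p (hv' n) _ j)
  have hcoeffB : ∀ n j, (p : ℤ_[p]) ^ (n / 2 - j) ∣ PowerSeries.coeff (j + 1) b := by
    intro n j
    rw [hB n, toIwasawa_X', PowerSeries.coeff_succ_X_mul, map_sub]
    exact dvd_sub (MAdic.dvd_coeff_mul_of_dvd_coeff p (hu' n) _ j)
      (MAdic.dvd_coeff_mul_of_dvd_coeff p (hu n) _ j)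
  have hzero : ∀ x : IwasawaAlgebra p,
      (x = toIwasawa p X * (Φ 1 * r 1 * v 0 - r 0 * v 1) ∨
        x = toIwasawa p X * (r 0 * u 1 - Φ 1 * r 1 * u 0)) →
      (∀ n j, (p : ℤ_[p]) ^ (n / 2 - j) ∣ PowerSeries.coeff (j + 1) x) → x = 0 := by
    intro x hx0 hx
    ext j
    rw [map_zero]
    cases j with
    | zero =>
      rcases hx0 with hx0 | hx0 <;>
        rw [hx0, toIwasawa_X', PowerSeries.coeff_zero_eq_constantCoeff, map_mul,
          PowerSeries.constantCoeff_X, zero_mul]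
    | succ j =>
      refine padicInt_eq_zero_of_forall_pow_dvd' _ fun k ↦ ?_
      have hk := hx (2 * (j + k)) j
      rwa [show 2 * (j + k) / 2 - j = k from by omega] at hk
  have ha0 : a = 0 := hzero a (Or.inl (hA 0)) hcoeffA
  have hb0 : b = 0 := hzero b (Or.inr (hB 0)) hcoeffB
  exact ⟨sub_eq_zero.mp ha0, sub_eq_zero.mp hb0⟩


/-- **Exactly one odd-branch pair at a good supersingular `2`**: existence
(`exists_isSprungPairOdd_two`) with uniqueness (`IsSprungPairOdd.unique`). [cite: Sprung2017, Thm. 1.12] -/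
theorem existsUnique_isSprungPairOdd_two [NeZero N] {W : WeierstrassCurve ℚ} [W.IsElliptic]
    [W.IsGloballyMinimal] (hf : IsNewformOf W f) (hgood : W.HasGoodReductionAtPrime 2)
    (hap : (2 : ℤ) ∣ W.frobeniusTrace 2) :
    ∃! LL : IwasawaAlgebra 2 × IwasawaAlgebra 2,
      IsSprungPairOdd f 2 (W.frobeniusTrace 2) LL.1 LL.2 := by
  obtain ⟨Ls, Lf, h⟩ := exists_isSprungPairOdd_two hf hgood hap
  refine ⟨(Ls, Lf), h, fun LL hLL ↦ ?_⟩
  obtain ⟨h1, h2⟩ := hLL.unique (by exact_mod_cast hap) h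
  exact Prod.ext h1 h2

end Unique


end Literature.NumberTheory.EllipticCurves.Sprung2017
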